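import Summits.AnomalousDissipation.AnomalousDissipation.Theorems.SolenoidalFractalHomogenisationLagrangianCarrierConstructionTowerWindows
import HarnessLib

/-!
# K3L `LagrangianCarrierConstruction` (stmt-AnomalousDissipation-24913), line `birth`, stub `stub_flowsL`:
# the inductive step of the Lagrangian tower, I — window structure (helper; `--supports stmt-AnomalousDissipation-24913`)

Summits-side helper file (everything proved; no definitions, no named facts). The Lagrangian tower is built level by
level: given the absolute flow `A t : ℝ^d ≃ ℝ^d` of the coarse levels (lifted to `ℝ^d`, lattice equivariant) and the evolution
`Z t s` (from time `s` to time `t`) of the next Eulerian level field, the absolute flow of the next level on the refresh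
window `[jR, (j+1)R]` is the WINDOW FORMULA
`F j t = A t ∘ A(jR)⁻¹ ∘ Z(t, jR) ∘ C j`
(coarse flow after the window's Eulerian flow — the interaction picture — after the accumulated map `C j` of the earlier
windows, `C (j+1) = F j ((j+1)R)`, `C 0 = id`; `…TowerWindows.exists_int_chain`). Here, with all objects passed as
hypotheses (no definitions):
* `exists_flowEquiv` — the evolution maps of a uniformly Lipschitz field as a two-parameter family of bijections;
* `window_formula_eq` — the KEY structural fact: on the CLOSED window `[jR, (j+1)R]` the formula selected by the window
  index `⌊t/R⌋` agrees with `F j` (at the right end by the recursion of `C`), so one-sided neighbourhoods of every time and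
  two-sided neighbourhoods of non-boundary times see a single smooth formula;
* lattice equivariance and `C¹` regularity (with bounded derivatives) of the accumulated maps `C j`, their inverses, and of
  the window formula, by two-sided induction over the windows.
Infrastructure for the construction side of route-1's rung leaf F-D1.A0 (a frontier formal rung); NOT a proof of anomalous
dissipation.
-/

set_option linter.dupNamespace false

noncomputable section

namespace Summit.AnomalousDissipation.AnomalousDissipation.Theorems.SolenoidalFractalHomogenisation.LagrangianCarrierConstruction

open Set Function Filter Topology Metric
open scoped NNReal
open Literature.Analysis.ODE Literature.Analysis.FunctionSpaces

section Flow

variable {V : Type*} [NormedAddCommGroup V] [NormedSpace ℝ V] [CompleteSpace V]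

/-- **The evolution maps as bijections**: for a field with the Cauchy–Lipschitz hypotheses on `ℝ` there is a family
`Z t s : V ≃ V` with `Z t s = φ(t, s, ·)` (evolve from `s` to `t`) and `(Z t s)⁻¹ = φ(s, t, ·)`. [folklore] -/
theorem exists_flowEquiv {v : ℝ → V → V} (hv : IsUniformlyLipschitzOn v univ) :
    ∃ Z : ℝ → ℝ → V ≃ V, (∀ t s z, Z t s z = evolutionMap v s t z) ∧ (∀ t s z, (Z t s).symm z = evolutionMap v t s z) :=
  ⟨fun t s => hv.evolutionMapEquiv convex_univ (mem_univ s) (mem_univ t), fun _ _ _ => rfl, fun _ _ _ => rfl⟩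

end Flow

section Window

variable {V : Type*}
variable (A : ℝ → V ≃ V) (Z : ℝ → ℝ → V ≃ V) (C : ℤ → V ≃ V) (R : ℝ)

/-- **The window formula on a closed window.** If `C (j+1) = C j ∘⋯` is the accumulation recursion
`C (j+1) = (C j).trans ((Z ((j+1)R) (jR)).trans ((A (jR))⁻¹.trans (A ((j+1)R))))` and `Z t t = id`, then for every `t` in
the CLOSED window `[jR, (j+1)R]` the formula selected by the window index `⌊t/R⌋` coincides with the window-`j` formula.
[folklore] -/
theorem window_formula_eq (hR : 0 < R) (hZself : ∀ t z, Z t t z = z)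
    (hC : ∀ j : ℤ, C (j + 1) = (C j).trans ((Z (((j : ℝ) + 1) * R) ((j : ℝ) * R)).trans
      ((A ((j : ℝ) * R)).symm.trans (A (((j : ℝ) + 1) * R)))))
    {j : ℤ} {t : ℝ} (ht : t ∈ Icc ((j : ℝ) * R) (((j : ℝ) + 1) * R)) (z : V) :
    ((C ⌊t / R⌋).trans ((Z t ((⌊t / R⌋ : ℝ) * R)).trans ((A ((⌊t / R⌋ : ℝ) * R)).symm.trans (A t)))) z =
      ((C j).trans ((Z t ((j : ℝ) * R)).trans ((A ((j : ℝ) * R)).symm.trans (A t)))) z := by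
  rcases lt_or_eq_of_le ht.2 with hlt | heq
  · rw [floor_eq_of_mem_Ico hR ⟨ht.1, hlt⟩]
  · -- right end of the window: `⌊t/R⌋ = j + 1` and the recursion of `C`
    have hfl : ⌊t / R⌋ = j + 1 := by
      rw [heq, mul_div_cancel_right₀ _ hR.ne', show ((j : ℝ) + 1) = ((j + 1 : ℤ) : ℝ) by push_cast; ring,
        Int.floor_intCast]
    rw [hfl, hC j]
    push_cast
    rw [← heq]
    simp [hZself]

/-- Right neighbourhoods: for every `r` there is `ε > 0` such that on `[r, r + ε]` the formula selected by `⌊t/R⌋` is the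
window-`⌊r/R⌋` formula. [folklore] -/
theorem window_formula_eq_right (hR : 0 < R) (hZself : ∀ t z, Z t t z = z)
    (hC : ∀ j : ℤ, C (j + 1) = (C j).trans ((Z (((j : ℝ) + 1) * R) ((j : ℝ) * R)).trans
      ((A ((j : ℝ) * R)).symm.trans (A (((j : ℝ) + 1) * R))))) (r : ℝ) :
    ∃ ε > 0, ∀ t ∈ Icc r (r + ε), ∀ z,
      ((C ⌊t / R⌋).trans ((Z t ((⌊t / R⌋ : ℝ) * R)).trans ((A ((⌊t / R⌋ : ℝ) * R)).symm.trans (A t)))) z =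
      ((C ⌊r / R⌋).trans ((Z t ((⌊r / R⌋ : ℝ) * R)).trans ((A ((⌊r / R⌋ : ℝ) * R)).symm.trans (A t)))) z := by
  obtain ⟨ε, hε, hsub⟩ := exists_Icc_right_subset_window hR r
  exact ⟨ε, hε, fun t ht z => window_formula_eq A Z C R hR hZself hC (hsub ht) z⟩

/-- Left neighbourhoods: on `[r − ε, r]` the formula is the window-`(⌈r/R⌉ − 1)` formula. [folklore] -/
theorem window_formula_eq_left (hR : 0 < R) (hZself : ∀ t z, Z t t z = z)
    (hC : ∀ j : ℤ, C (j + 1) = (C j).trans ((Z (((j : ℝ) + 1) * R) ((j : ℝ) * R)).trans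
      ((A ((j : ℝ) * R)).symm.trans (A (((j : ℝ) + 1) * R))))) (r : ℝ) :
    ∃ ε > 0, ∀ t ∈ Icc (r - ε) r, ∀ z,
      ((C ⌊t / R⌋).trans ((Z t ((⌊t / R⌋ : ℝ) * R)).trans ((A ((⌊t / R⌋ : ℝ) * R)).symm.trans (A t)))) z =
      ((C (⌈r / R⌉ - 1)).trans ((Z t (((⌈r / R⌉ - 1 : ℤ) : ℝ) * R)).trans
        ((A (((⌈r / R⌉ - 1 : ℤ) : ℝ) * R)).symm.trans (A t)))) z := by
  obtain ⟨ε, hε, hsub⟩ := exists_Icc_left_subset_window hR r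
  exact ⟨ε, hε, fun t ht z => window_formula_eq A Z C R hR hZself hC (hsub ht) z⟩

/-- Two-sided neighbourhoods off the window boundaries: on `[t − ε, t + ε]` the formula is the window-`⌊t/R⌋` formula.
[folklore] -/
theorem window_formula_eq_two_sided (hR : 0 < R) (hZself : ∀ t z, Z t t z = z)
    (hC : ∀ j : ℤ, C (j + 1) = (C j).trans ((Z (((j : ℝ) + 1) * R) ((j : ℝ) * R)).trans
      ((A ((j : ℝ) * R)).symm.trans (A (((j : ℝ) + 1) * R))))) {t : ℝ} (ht : ∀ j : ℤ, t ≠ (j : ℝ) * R) :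
    ∃ ε > 0, ∀ τ ∈ Icc (t - ε) (t + ε), ∀ z,
      ((C ⌊τ / R⌋).trans ((Z τ ((⌊τ / R⌋ : ℝ) * R)).trans ((A ((⌊τ / R⌋ : ℝ) * R)).symm.trans (A τ)))) z =
      ((C ⌊t / R⌋).trans ((Z τ ((⌊t / R⌋ : ℝ) * R)).trans ((A ((⌊t / R⌋ : ℝ) * R)).symm.trans (A τ)))) z := by
  obtain ⟨ε, hε, hsub⟩ := exists_Icc_subset_Ioo_window hR ht
  exact ⟨ε, hε, fun τ hτ z => window_formula_eq A Z C R hR hZself hC (Ioo_subset_Icc_self (hsub hτ)) z⟩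

end Window

section Chain

variable {V : Type*} (C M : ℤ → V ≃ V)

/-- Backward form of the accumulation recursion: `C (j − 1) = (C j).trans (M (j − 1))⁻¹`. [folklore] -/
theorem chain_pred (hC : ∀ j : ℤ, C (j + 1) = (C j).trans (M j)) (j : ℤ) :
    C (j - 1) = (C j).trans (M (j - 1)).symm := by
  have h := hC (j - 1)
  rw [sub_add_cancel] at h
  rw [h, Equiv.trans_assoc, Equiv.self_trans_symm, Equiv.trans_refl]

/-- **Two-sided induction along the accumulation recursion**: a property of bijections stable under `trans` with the
transition maps and with their inverses, and true for `id`, holds for every accumulated map `C j`. [folklore] -/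
theorem chain_induction {P : (V ≃ V) → Prop} (hC0 : C 0 = Equiv.refl V) (hC : ∀ j : ℤ, C (j + 1) = (C j).trans (M j))
    (h0 : P (Equiv.refl V)) (hstep : ∀ (j : ℤ) (e : V ≃ V), P e → P (e.trans (M j)))
    (hback : ∀ (j : ℤ) (e : V ≃ V), P e → P (e.trans (M j).symm)) : ∀ j : ℤ, P (C j) := by
  intro j
  induction j using Int.induction_on with
  | zero => rw [hC0]; exact h0
  | succ i ih => rw [hC]; exact hstep _ _ ih
  | pred i ih =>
    have e := chain_pred C M hC (-(i : ℤ))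
    rw [e]
    exact hback _ _ ih

end Chain

section Equivariance

variable {d : Type*} [Fintype d] [DecidableEq d]

/-- `trans` preserves lattice equivariance. [folklore] -/
theorem equivariant_trans {e f : EuclideanSpace ℝ d ≃ EuclideanSpace ℝ d}
    (he : ∀ z (k : d → ℤ), e (z + Torus.latticeVec k) = e z + Torus.latticeVec k)
    (hf : ∀ z (k : d → ℤ), f (z + Torus.latticeVec k) = f z + Torus.latticeVec k)
    (z : EuclideanSpace ℝ d) (k : d → ℤ) : (e.trans f) (z + Torus.latticeVec k) = (e.trans f) z + Torus.latticeVec k := by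
  simp only [Equiv.trans_apply]
  rw [he, hf]

/-- **The accumulated window maps are lattice equivariant** when the transition maps are. [folklore] -/
theorem equivariant_chain (C M : ℤ → EuclideanSpace ℝ d ≃ EuclideanSpace ℝ d) (hC0 : C 0 = Equiv.refl _)
    (hC : ∀ j : ℤ, C (j + 1) = (C j).trans (M j))
    (hM : ∀ (j : ℤ) z (k : d → ℤ), M j (z + Torus.latticeVec k) = M j z + Torus.latticeVec k) :
    ∀ (j : ℤ) z (k : d → ℤ), C j (z + Torus.latticeVec k) = C j z + Torus.latticeVec k :=
  chain_induction C M (P := fun e => ∀ z (k : d → ℤ), e (z + Torus.latticeVec k) = e z + Torus.latticeVec k) hC0 hC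
    (fun z k => by simp) (fun j e he => equivariant_trans he (hM j))
    (fun j e he => equivariant_trans he (equivariant_symm (hM j)))

/-- The transition map `M j = A((j+1)R) ∘ A(jR)⁻¹ ∘ Z((j+1)R, jR)` and, more generally, every window formula
`A t ∘ (A s)⁻¹ ∘ Z t s ∘ C` is lattice equivariant when its factors are. [folklore] -/
theorem equivariant_window_formula (A : ℝ → EuclideanSpace ℝ d ≃ EuclideanSpace ℝ d)
    (Z : ℝ → ℝ → EuclideanSpace ℝ d ≃ EuclideanSpace ℝ d) (C : EuclideanSpace ℝ d ≃ EuclideanSpace ℝ d)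
    (hA : ∀ t z (k : d → ℤ), A t (z + Torus.latticeVec k) = A t z + Torus.latticeVec k)
    (hZ : ∀ t s z (k : d → ℤ), Z t s (z + Torus.latticeVec k) = Z t s z + Torus.latticeVec k)
    (hCj : ∀ z (k : d → ℤ), C (z + Torus.latticeVec k) = C z + Torus.latticeVec k)
    (t s : ℝ) (z : EuclideanSpace ℝ d) (k : d → ℤ) :
    (C.trans ((Z t s).trans ((A s).symm.trans (A t)))) (z + Torus.latticeVec k) =
      (C.trans ((Z t s).trans ((A s).symm.trans (A t)))) z + Torus.latticeVec k := by
  simp only [Equiv.trans_apply]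
  rw [hCj, hZ, equivariant_symm (hA _), hA]

end Equivariance

section Smoothness

variable {V : Type*} [NormedAddCommGroup V] [NormedSpace ℝ V]

/-- `trans` preserves `C¹`-with-`C¹`-inverse. [folklore] -/
theorem contDiff_trans {e f : V ≃ V} (he : ContDiff ℝ 1 e ∧ ContDiff ℝ 1 e.symm)
    (hf : ContDiff ℝ 1 f ∧ ContDiff ℝ 1 f.symm) : ContDiff ℝ 1 (e.trans f) ∧ ContDiff ℝ 1 (e.trans f).symm := by
  refine ⟨?_, ?_⟩
  · rw [Equiv.coe_trans]; exact hf.1.comp he.1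
  · have h : ⇑(e.trans f).symm = e.symm ∘ f.symm := by funext z; simp
    rw [h]; exact he.2.comp hf.2

/-- A bijection and its inverse: swapping the roles. [folklore] -/
theorem contDiff_symm {e : V ≃ V} (he : ContDiff ℝ 1 e ∧ ContDiff ℝ 1 e.symm) :
    ContDiff ℝ 1 e.symm ∧ ContDiff ℝ 1 e.symm.symm := by
  rw [Equiv.symm_symm]; exact ⟨he.2, he.1⟩

/-- **The accumulated window maps and their inverses are `C¹`** when the transition maps are. [folklore] -/
theorem contDiff_chain (C M : ℤ → V ≃ V) (hC0 : C 0 = Equiv.refl _) (hC : ∀ j : ℤ, C (j + 1) = (C j).trans (M j))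
    (hM : ∀ j : ℤ, ContDiff ℝ 1 (M j) ∧ ContDiff ℝ 1 (M j).symm) :
    ∀ j : ℤ, ContDiff ℝ 1 (C j) ∧ ContDiff ℝ 1 (C j).symm :=
  chain_induction C M (P := fun e => ContDiff ℝ 1 e ∧ ContDiff ℝ 1 e.symm) hC0 hC
    (by rw [Equiv.refl_symm]; exact ⟨contDiff_id, contDiff_id⟩) (fun j e he => contDiff_trans he (hM j))
    (fun j e he => contDiff_trans he (contDiff_symm (hM j)))

/-- The window formula and its inverse are `C¹` when its factors are. [folklore] -/
theorem contDiff_window_formula (A : ℝ → V ≃ V) (Z : ℝ → ℝ → V ≃ V) (C : V ≃ V)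
    (hA : ∀ t, ContDiff ℝ 1 (A t) ∧ ContDiff ℝ 1 (A t).symm) (hZ : ∀ t s, ContDiff ℝ 1 (Z t s) ∧ ContDiff ℝ 1 (Z t s).symm)
    (hCj : ContDiff ℝ 1 C ∧ ContDiff ℝ 1 C.symm) (t s : ℝ) :
    ContDiff ℝ 1 (C.trans ((Z t s).trans ((A s).symm.trans (A t)))) ∧
      ContDiff ℝ 1 (C.trans ((Z t s).trans ((A s).symm.trans (A t)))).symm :=
  contDiff_trans hCj (contDiff_trans (hZ t s) (contDiff_trans (contDiff_symm (hA s)) (hA t)))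

end Smoothness

end Summit.AnomalousDissipation.AnomalousDissipation.Theorems.SolenoidalFractalHomogenisation.LagrangianCarrierConstruction

end
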